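import Literature.Geometry.Manifold.QuotientMaps
import Literature.Topology.CoveringSpaces.OrbitQuotientCovering
import Mathlib.Geometry.Manifold.Diffeomorph

/-!
# Deck transformations and quotients in stages of quotient manifolds

Let a group `G` act freely and properly discontinuously by `C^n` maps on a `C^n` manifold `M`
(so `M/G` is a `C^n` manifold and `mk : M → M/G` a `C^n` local diffeomorphism,
`Literature/Geometry/Manifold/QuotientManifold.lean`, `QuotientMaps.lean`), and let `N ⊴ G` be a
normal subgroup. The quotient group `G ⧸ N` acts on the intermediate quotient `M/N`
(`Literature.Topology.CoveringSpaces.OrbitQuotient.mulAction`, `(gN) • [x] = [g • x]`; that file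
proves the action is free, by homeomorphisms and properly discontinuous, and that `M/N → M/G` is
the quotient covering map of `G ⧸ N`). This file adds the `C^n` layer:

* `toQuotient N : M/N → M/G`, the map induced by `N ≤ G`, is a `C^n` local diffeomorphism and
  the quotient covering map of the deck action of `G ⧸ N` (`contMDiff_toQuotient`,
  `isLocalDiffeomorph_toQuotient`, `isQuotientCoveringMap_toQuotient`);
* the deck transformations `[x] ↦ [g • x]` of `M/N` are `C^n` diffeomorphisms
  (`contMDiff_quotientSMul`, `deckDiffeomorph`);
* **quotients in stages**: `(M/N)/(G ⧸ N)` is a `C^n` manifold (`isManifold_stages`) and the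
  canonical bijection `(M/N)/(G ⧸ N) → M/G` is a homeomorphism (`stagesHomeomorph`, for any
  action) and a `C^n` diffeomorphism (`stagesDiffeomorph`).

Source: standard (J. M. Lee, *Introduction to Smooth Manifolds*, 2nd ed., Thm 21.13 and
Ch. 21, quotients by free proper actions of discrete groups; A. Hatcher, *Algebraic Topology*,
§1.3, Prop. 1.40 (deck group `G/N` of the intermediate covering of a normal covering));
tagged folklore. Ported from the Hodge–Picard-modular adjudication package
(`HodgeCM/PerL34/HolomorphicDeck.lean`, 2026-08-18: there for subgroups `Γ₁ ⊴ Γ` of finite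
index and the deck group realised inside `Perm (M/Γ₁)`), re-typed over `OrbitQuotient.mulAction`.
-/

open scoped Manifold ContDiff
open Set Function MulAction Topology
open Literature.Topology.CoveringSpaces

noncomputable section

namespace Literature.Geometry.Manifold

namespace QuotientManifold

section Algebra

variable {G : Type*} [Group G] {M : Type*} [MulAction G M] (N : Subgroup G)

/-- The map `M/N → M/G`, `[x]_N ↦ [x]_G`, induced by a subgroup `N ≤ G` (no topology).
[folklore] -/
def toQuotient : orbitRel.Quotient N M → orbitRel.Quotient G M :=
  Quotient.lift (Quotient.mk (orbitRel G M)) fun _ _ h => Quotient.sound (orbitRel_subgroup_le N h)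

/-- `toQuotient N [x]_N = [x]_G`. [folklore] -/
@[simp] theorem toQuotient_mk (x : M) :
    toQuotient N (Quotient.mk (orbitRel N M) x) = Quotient.mk (orbitRel G M) x := rfl

/-- `toQuotient N ∘ [·]_N = [·]_G`. [folklore] -/
theorem toQuotient_comp_mk :
    toQuotient N ∘ Quotient.mk (orbitRel N M) = Quotient.mk (orbitRel G M) := rfl

/-- `toQuotient N` is surjective. [folklore] -/
theorem toQuotient_surjective : Surjective (toQuotient N (M := M)) := by
  rintro ⟨x⟩
  exact ⟨Quotient.mk _ x, rfl⟩

variable [hN : N.Normal]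

/-- `toQuotient N` is invariant under the deck action of `G ⧸ N` on `M/N`. [folklore] -/
@[simp] theorem toQuotient_smul (q : G ⧸ N) (y : orbitRel.Quotient N M) :
    toQuotient N (q • y) = toQuotient N y := by
  induction q using QuotientGroup.induction_on with
  | H g =>
  induction y using Quotient.inductionOn with
  | h x =>
    rw [OrbitQuotient.mk_smul_mk, toQuotient_mk, toQuotient_mk]
    exact Quotient.sound ⟨g, rfl⟩

/-- The fibres of `toQuotient N` are the `G ⧸ N`-orbits. [folklore] -/
theorem toQuotient_eq_toQuotient_iff {y₁ y₂ : orbitRel.Quotient N M} :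
    toQuotient N y₁ = toQuotient N y₂ ↔ y₁ ∈ orbit (G ⧸ N) y₂ := by
  induction y₁ using Quotient.inductionOn with
  | h x₁ =>
  induction y₂ using Quotient.inductionOn with
  | h x₂ =>
    rw [toQuotient_mk, toQuotient_mk, OrbitQuotient.mk_mem_orbit_mk_iff]
    exact Quotient.eq (r := orbitRel G M)

/-- **The canonical map `(M/N)/(G ⧸ N) → M/G`**, `[[x]_N] ↦ [x]_G`. [folklore] -/
def stagesMap : orbitRel.Quotient (G ⧸ N) (orbitRel.Quotient N M) → orbitRel.Quotient G M :=
  Quotient.lift (toQuotient N) fun _ _ h => (toQuotient_eq_toQuotient_iff N).mpr h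

/-- `stagesMap N [y] = toQuotient N y`. [folklore] -/
@[simp] theorem stagesMap_mk (y : orbitRel.Quotient N M) :
    stagesMap N (Quotient.mk (orbitRel (G ⧸ N) (orbitRel.Quotient N M)) y) = toQuotient N y :=
  rfl

/-- `stagesMap N [[x]_N] = [x]_G`. [folklore] -/
theorem stagesMap_mk_mk (x : M) :
    stagesMap N (Quotient.mk (orbitRel (G ⧸ N) (orbitRel.Quotient N M))
      (Quotient.mk (orbitRel N M) x)) = Quotient.mk (orbitRel G M) x :=
  rfl

/-- `stagesMap N ∘ [·] = toQuotient N`. [folklore] -/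
theorem stagesMap_comp_mk :
    stagesMap N ∘ Quotient.mk (orbitRel (G ⧸ N) (orbitRel.Quotient N M)) = toQuotient N := rfl

/-- `stagesMap N` is a bijection. [folklore] -/
theorem stagesMap_bijective : Bijective (stagesMap N (M := M)) := by
  refine ⟨?_, ?_⟩
  · rintro ⟨y₁⟩ ⟨y₂⟩ h
    exact Quotient.sound ((toQuotient_eq_toQuotient_iff N).mp h)
  · rintro ⟨x⟩
    exact ⟨Quotient.mk _ (Quotient.mk _ x), rfl⟩

/-- The canonical bijection `(M/N)/(G ⧸ N) ≃ M/G` (no topology). [folklore] -/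
def stagesEquiv : orbitRel.Quotient (G ⧸ N) (orbitRel.Quotient N M) ≃ orbitRel.Quotient G M :=
  Equiv.ofBijective (stagesMap N) (stagesMap_bijective N)

/-- `stagesEquiv N` is `stagesMap N`. [folklore] -/
@[simp] theorem coe_stagesEquiv :
    ⇑(stagesEquiv N (M := M)) = stagesMap N := rfl

/-- The inverse of `stagesEquiv N` sends `[x]_G` to `[[x]_N]`. [folklore] -/
@[simp] theorem stagesEquiv_symm_mk (x : M) :
    (stagesEquiv N (M := M)).symm (Quotient.mk (orbitRel G M) x) =
      Quotient.mk (orbitRel (G ⧸ N) (orbitRel.Quotient N M)) (Quotient.mk (orbitRel N M) x) :=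
  (stagesEquiv N).symm_apply_eq.mpr rfl

/-- `(stagesEquiv N).symm ∘ [·]_G = [·] ∘ [·]_N`. [folklore] -/
theorem stagesEquiv_symm_comp_mk :
    (stagesEquiv N (M := M)).symm ∘ Quotient.mk (orbitRel G M) =
      Quotient.mk (orbitRel (G ⧸ N) (orbitRel.Quotient N M)) ∘ Quotient.mk (orbitRel N M) :=
  funext (stagesEquiv_symm_mk N)

end Algebra

section Topology

variable {G : Type*} [Group G] {M : Type*} [TopologicalSpace M] [MulAction G M] (N : Subgroup G)

/-- `toQuotient N : M/N → M/G` is a quotient map (for any action). [folklore] -/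
theorem isQuotientMap_toQuotient : IsQuotientMap (toQuotient N (M := M)) :=
  isQuotientMap_quotient_mk'.of_comp_isQuotientMap
    (show IsQuotientMap (toQuotient N ∘ Quotient.mk (orbitRel N M)) from
      isQuotientMap_quotient_mk')

/-- `toQuotient N` is continuous. [folklore] -/
theorem continuous_toQuotient : Continuous (toQuotient N (M := M)) :=
  (isQuotientMap_toQuotient N).continuous

variable [hN : N.Normal]

/-- `stagesMap N : (M/N)/(G ⧸ N) → M/G` is a quotient map (for any action). [folklore] -/
theorem isQuotientMap_stagesMap : IsQuotientMap (stagesMap N (M := M)) :=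
  isQuotientMap_quotient_mk'.of_comp_isQuotientMap
    (show IsQuotientMap (stagesMap N ∘ Quotient.mk _) from isQuotientMap_toQuotient N)

/-- `stagesMap N` is a homeomorphism onto `M/G` (a bijective quotient map). [folklore] -/
theorem isHomeomorph_stagesMap : IsHomeomorph (stagesMap N (M := M)) :=
  isHomeomorph_iff_isQuotientMap_injective.mpr
    ⟨isQuotientMap_stagesMap N, (stagesMap_bijective N).injective⟩

/-- **Quotients in stages, topologically: `(M/N)/(G ⧸ N) ≃ₜ M/G`** for any action of `G` on a
topological space `M` and any normal subgroup `N`. [folklore] -/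
def stagesHomeomorph :
    orbitRel.Quotient (G ⧸ N) (orbitRel.Quotient N M) ≃ₜ orbitRel.Quotient G M :=
  IsHomeomorph.homeomorph (stagesMap N) (isHomeomorph_stagesMap N)

/-- `stagesHomeomorph N` is `stagesMap N`. [folklore] -/
@[simp] theorem coe_stagesHomeomorph : ⇑(stagesHomeomorph N (M := M)) = stagesMap N := rfl

/-- The underlying equivalence of `stagesHomeomorph N` is `stagesEquiv N`. [folklore] -/
theorem stagesHomeomorph_toEquiv : (stagesHomeomorph N (M := M)).toEquiv = stagesEquiv N :=
  Equiv.ext fun _ => rfl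

/-- The inverse of `stagesHomeomorph N` sends `[x]_G` to `[[x]_N]`. [folklore] -/
@[simp] theorem stagesHomeomorph_symm_mk (x : M) :
    (stagesHomeomorph N (M := M)).symm (Quotient.mk (orbitRel G M) x) =
      Quotient.mk (orbitRel (G ⧸ N) (orbitRel.Quotient N M)) (Quotient.mk (orbitRel N M) x) :=
  (stagesHomeomorph N).symm_apply_eq.mpr rfl

variable [ProperlyDiscontinuousSMul G M] [ContinuousConstSMul G M] [IsCancelSMul G M] [T2Space M]
  [LocallyCompactSpace M]

/-- **`M/N → M/G` is a Galois covering with group `G ⧸ N`**: for a free, properly discontinuous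
action of `G` on a locally compact Hausdorff space `M`, `toQuotient N` is the quotient covering
map of the (free, properly discontinuous) deck action of `G ⧸ N` on `M/N`
(`OrbitQuotient.isQuotientCoveringMap_lift`). [folklore] -/
theorem isQuotientCoveringMap_toQuotient :
    IsQuotientCoveringMap (toQuotient N (M := M)) (G ⧸ N) :=
  OrbitQuotient.isQuotientCoveringMap_lift N isQuotientMap_quotient_mk'
    (fun {_ _} => mk_eq_mk_iff.trans MulAction.mem_orbit_iff.symm) fun _ => rfl

/-- `M/N → M/G` is a covering map. [folklore] -/
theorem isCoveringMap_toQuotient : IsCoveringMap (toQuotient N (M := M)) :=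
  (isQuotientCoveringMap_toQuotient N).isCoveringMap

end Topology

/-! ## The `C^n` layer -/

section Smooth

variable {𝕜 : Type*} [NontriviallyNormedField 𝕜] {E : Type*} [NormedAddCommGroup E]
  [NormedSpace 𝕜 E] {H : Type*} [TopologicalSpace H] {I : ModelWithCorners 𝕜 E H} {n : ℕ∞ω}
  {G : Type*} [Group G] {M : Type*} [TopologicalSpace M] [MulAction G M] [ChartedSpace H M]
  (N : Subgroup G)

/-- A subgroup of a group acting by `C^n` maps acts by `C^n` maps. [folklore] -/
theorem contMDiff_subgroupSMul (hsmooth : ∀ g : G, ContMDiff I I n (fun x : M => g • x))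
    (s : N) : ContMDiff I I n (fun x : M => s • x) :=
  hsmooth s

variable [ProperlyDiscontinuousSMul G M] [ContinuousConstSMul G M] [IsCancelSMul G M] [T2Space M]
  [LocallyCompactSpace M] [IsManifold I n M]

/-- `M/N` is a `C^n` manifold (`QuotientManifold.isManifold` for the subgroup). [folklore] -/
theorem isManifold_subgroup (hsmooth : ∀ g : G, ContMDiff I I n (fun x : M => g • x)) :
    IsManifold I n (orbitRel.Quotient N M) :=
  isManifold (contMDiff_subgroupSMul N hsmooth)

/-- **`toQuotient N : M/N → M/G` is `C^n`** (a map of quotients over `M`,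
`QuotientMaps.contMDiff_of_comp_mk_eq`). [folklore] -/
theorem contMDiff_toQuotient (hsmooth : ∀ g : G, ContMDiff I I n (fun x : M => g • x)) :
    ContMDiff I I n (toQuotient N (M := M)) :=
  contMDiff_of_comp_mk_eq (contMDiff_subgroupSMul N hsmooth) hsmooth _ fun _ => rfl

/-- **`toQuotient N : M/N → M/G` is a `C^n` local diffeomorphism.** [folklore] -/
theorem isLocalDiffeomorph_toQuotient
    (hsmooth : ∀ g : G, ContMDiff I I n (fun x : M => g • x)) :
    IsLocalDiffeomorph I I n (toQuotient N (M := M)) :=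
  isLocalDiffeomorph_of_comp_mk_eq (contMDiff_subgroupSMul N hsmooth) hsmooth _ fun _ => rfl

variable [hN : N.Normal]

/-- **Deck transformations are `C^n`**: for `q : G ⧸ N`, the map `y ↦ q • y` of `M/N` is `C^n`
(descent of `[·]_N ∘ (g • ·)` along `[·]_N`). [folklore] -/
theorem contMDiff_quotientSMul (hsmooth : ∀ g : G, ContMDiff I I n (fun x : M => g • x))
    (q : G ⧸ N) : ContMDiff I I n (fun y : orbitRel.Quotient N M => q • y) := by
  induction q using QuotientGroup.induction_on with
  | H g =>
    refine (contMDiff_comp_mk_iff (contMDiff_subgroupSMul N hsmooth)).mp ?_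
    have heq :
        (fun y : orbitRel.Quotient N M => (QuotientGroup.mk g : G ⧸ N) • y) ∘ mk (G := N) =
          mk (G := N) ∘ fun x : M => g • x :=
      funext fun x => OrbitQuotient.mk_smul_mk N g x
    rw [heq]
    exact (contMDiff_mk (contMDiff_subgroupSMul N hsmooth)).comp (hsmooth g)

/-- **The deck transformation `y ↦ q • y` (`q : G ⧸ N`) as a `C^n` diffeomorphism of `M/N`.**
[folklore] -/
def deckDiffeomorph (hsmooth : ∀ g : G, ContMDiff I I n (fun x : M => g • x)) (q : G ⧸ N) :
    orbitRel.Quotient N M ≃ₘ^n⟮I, I⟯ orbitRel.Quotient N M where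
  toEquiv := MulAction.toPerm q
  contMDiff_toFun := contMDiff_quotientSMul N hsmooth q
  contMDiff_invFun := contMDiff_quotientSMul N hsmooth q⁻¹

/-- `deckDiffeomorph N hsmooth q y = q • y`. [folklore] -/
@[simp] theorem deckDiffeomorph_apply (hsmooth : ∀ g : G, ContMDiff I I n (fun x : M => g • x))
    (q : G ⧸ N) (y : orbitRel.Quotient N M) : deckDiffeomorph N hsmooth q y = q • y := rfl

/-- `deckDiffeomorph N hsmooth [g] [x]_N = [g • x]_N`. [folklore] -/
theorem deckDiffeomorph_mk_mk (hsmooth : ∀ g : G, ContMDiff I I n (fun x : M => g • x))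
    (g : G) (x : M) :
    deckDiffeomorph N hsmooth (QuotientGroup.mk g) (mk (G := N) x) = mk (G := N) (g • x) :=
  OrbitQuotient.mk_smul_mk N g x

/-- The deck transformations preserve the fibres of `M/N → M/G`. [folklore] -/
theorem toQuotient_deckDiffeomorph (hsmooth : ∀ g : G, ContMDiff I I n (fun x : M => g • x))
    (q : G ⧸ N) (y : orbitRel.Quotient N M) :
    toQuotient N (deckDiffeomorph N hsmooth q y) = toQuotient N y :=
  toQuotient_smul N q y

/-! ### Quotients in stages -/

/- The charted space structure on `(M/N)/(G ⧸ N)` is Mathlib's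
`MulAction.instChartedSpaceQuotient` for the deck action; it needs the deck action of `G ⧸ N` on
`M/N` to be free and properly discontinuous and `M/N` to be locally compact. These three
(`Prop`-valued) instances are THEOREMS of `Literature.Topology.CoveringSpaces.OrbitQuotient` (not
global instances there), so the statements below take them as instance arguments; discharge them
with
`haveI := OrbitQuotient.isCancelSMul N (X := M)`,
`haveI := OrbitQuotient.locallyCompactSpace N (X := M)` and
`haveI := OrbitQuotient.properlyDiscontinuousSMul N (X := M)`. -/

variable [ProperlyDiscontinuousSMul (G ⧸ N) (orbitRel.Quotient N M)]
  [IsCancelSMul (G ⧸ N) (orbitRel.Quotient N M)] [LocallyCompactSpace (orbitRel.Quotient N M)]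

/-- **`(M/N)/(G ⧸ N)` is a `C^n` manifold** (the deck action is by `C^n` maps; the instance
hypotheses on the deck action are discharged by `OrbitQuotient.properlyDiscontinuousSMul`,
`OrbitQuotient.isCancelSMul`, `OrbitQuotient.locallyCompactSpace`). [folklore] -/
theorem isManifold_stages (hsmooth : ∀ g : G, ContMDiff I I n (fun x : M => g • x)) :
    IsManifold I n (orbitRel.Quotient (G ⧸ N) (orbitRel.Quotient N M)) :=
  haveI := isManifold_subgroup (I := I) (n := n) N hsmooth
  isManifold (contMDiff_quotientSMul N hsmooth)

/-- The projection `M/N → (M/N)/(G ⧸ N)` is `C^n`. [folklore] -/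
theorem contMDiff_stagesMk (hsmooth : ∀ g : G, ContMDiff I I n (fun x : M => g • x)) :
    ContMDiff I I n (mk (G := G ⧸ N) (M := orbitRel.Quotient N M)) :=
  haveI := isManifold_subgroup (I := I) (n := n) N hsmooth
  contMDiff_mk (contMDiff_quotientSMul N hsmooth)

/-- **`stagesMap N : (M/N)/(G ⧸ N) → M/G` is `C^n`** (descent of `toQuotient N`). [folklore] -/
theorem contMDiff_stagesMap (hsmooth : ∀ g : G, ContMDiff I I n (fun x : M => g • x)) :
    ContMDiff I I n (stagesMap N (M := M)) :=
  haveI := isManifold_subgroup (I := I) (n := n) N hsmooth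
  (contMDiff_comp_mk_iff (contMDiff_quotientSMul N hsmooth)).mp (contMDiff_toQuotient N hsmooth)

/-- **The inverse `M/G → (M/N)/(G ⧸ N)` is `C^n`** (descent of `[·] ∘ [·]_N` along `[·]_G`).
[folklore] -/
theorem contMDiff_stagesHomeomorph_symm
    (hsmooth : ∀ g : G, ContMDiff I I n (fun x : M => g • x)) :
    ContMDiff I I n (stagesHomeomorph N (M := M)).symm := by
  refine (contMDiff_comp_mk_iff hsmooth).mp ?_
  rw [show ((stagesHomeomorph N (M := M)).symm ∘ mk (G := G)) =
      mk (G := G ⧸ N) (M := orbitRel.Quotient N M) ∘ mk (G := N) from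
    funext (stagesHomeomorph_symm_mk N)]
  exact (contMDiff_stagesMk N hsmooth).comp (contMDiff_mk (contMDiff_subgroupSMul N hsmooth))

/-- **Quotients in stages as `C^n` manifolds: `(M/N)/(G ⧸ N) ≃ₘ^n⟮I, I⟯ M/G`** (instance
hypotheses on the deck action: `OrbitQuotient.properlyDiscontinuousSMul`,
`OrbitQuotient.isCancelSMul`, `OrbitQuotient.locallyCompactSpace`). [folklore] -/
def stagesDiffeomorph (hsmooth : ∀ g : G, ContMDiff I I n (fun x : M => g • x)) :
    orbitRel.Quotient (G ⧸ N) (orbitRel.Quotient N M) ≃ₘ^n⟮I, I⟯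
      orbitRel.Quotient G M where
  toEquiv := (stagesHomeomorph N).toEquiv
  contMDiff_toFun := contMDiff_stagesMap N hsmooth
  contMDiff_invFun := contMDiff_stagesHomeomorph_symm N hsmooth

/-- `stagesDiffeomorph N hsmooth` is `stagesMap N`. [folklore] -/
@[simp] theorem coe_stagesDiffeomorph
    (hsmooth : ∀ g : G, ContMDiff I I n (fun x : M => g • x)) :
    ⇑(stagesDiffeomorph N hsmooth (I := I)) = stagesMap N := rfl

/-- `stagesDiffeomorph N hsmooth [[x]_N] = [x]_G`. [folklore] -/
theorem stagesDiffeomorph_mk_mk (hsmooth : ∀ g : G, ContMDiff I I n (fun x : M => g • x))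
    (x : M) :
    stagesDiffeomorph N hsmooth (I := I) (mk (G := G ⧸ N) (mk (G := N) x)) = mk (G := G) x := rfl

/-- The inverse of `stagesDiffeomorph N hsmooth` sends `[x]_G` to `[[x]_N]`. [folklore] -/
@[simp] theorem stagesDiffeomorph_symm_mk
    (hsmooth : ∀ g : G, ContMDiff I I n (fun x : M => g • x)) (x : M) :
    (stagesDiffeomorph N hsmooth (I := I)).symm (mk (G := G) x) =
      mk (G := G ⧸ N) (mk (G := N) x) :=
  stagesHomeomorph_symm_mk N x

end Smooth

end QuotientManifold

end Literature.Geometry.Manifold
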